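/-
Copyright (c) 2026 the pub-hodgecm-mathlib formalisation cell (harness21).  Prover seat hodgecm-mathlib-K2E3-p23 (g6), HCML Track B «K2-LIT» ∕ h413
(`stmt-HodgeConjecture-24833`), line `K2_E3_EllipticInputs`, road «GL₂-sc» (road owner K2E5-p17 (g5), dealer K2E3-plan (g4)), NON-ELLIPTIC half, brick 2N-7,
FILE 3 OF 4: the `Fin 2` reading of ★ ASM `K2E3GL3ModUniformizerNonEllEstimatesOfMixed` (K2E3-p23 (g5)) — THE LEAF BODY `∃ Fl M, (a.e. convergence) ∧ (a.e. domination) ∧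
M ∈ L¹_loc` ON `G' = GL₂(F) ⧸ ϖ^ℤ` FOR A GIVEN HEIGHT-BALL EXHAUSTION, MODULO the local integrability `hΦ` of the weight `1_{non-ell}·δ^{-(1∕2+ε)}` (★ 2N-6, K2E3-p24 (g0)).
UNCONDITIONAL otherwise (no mixed half at `N = 2`).  2026-09-04.
-/
import Summits.HodgeConjecture.HodgeConjecture.Theorems.K2E3GL2ModUniformizerNonEllCancellation        -- ★ 2N-7 F2 (this seat): `hcanc` packaged (`ae_setIntegral_conj_eq_inter`, `le_add_of_pow_eq_of_pow_mul_le`)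
import Summits.HodgeConjecture.HodgeConjecture.Theorems.K2E3GL2ModUniformizerNonEllBallWeight          -- ★ 2N-5 part 3 file 2 (K2E3-p17 g8): `ae_setIntegral_norm_conj_le_weight_sharp` — `hball` in the normalisation `δ = ‖disc‖∕‖det‖`, bound `M_θ·(c·(C m·2(2(R+(4h+L))+1)·q^h·δ^{-1∕2}))`
import Summits.HodgeConjecture.HodgeConjecture.Theorems.K2E3GL2ModUniformizerNonEllCoordinates         -- ★ 2N-7 F1 p859069 (this seat): `exists_coordinates` (`δ = ‖disc‖∕‖det‖`)
import Summits.HodgeConjecture.HodgeConjecture.Theorems.K2E3GL3ModUniformizerNonEllEstimatesOfMixed     -- ★ ASM (K2E3-p23 g5): GENERIC `toReal_bound_eq`, `inv_sqrt_coe_eq_rpow_mul_rpow`; brings ★ ASM-core `K2E3NonEllEstimatesOfRadius.nonEllEstimates_of_radius`, ★ generic `K2E3GL3ModUniformizerNonEllWeight.locallyIntegrable_mul_weightFactor`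
import HarnessLib

/-!
# Road «GL₂-sc», non-elliptic half, brick 2N-7 (file 3 of 4) — the leaf body on `G' = GL₂(F) ⧸ ϖ^ℤ` for a given exhaustion, modulo the weight's local integrability

Cell `pub/hodgecm-mathlib` (D-0151), Track B «K2-LIT», crux H413 = `stmt-HodgeConjecture-24833`, route of record `HCCMUnconditional`.  Lane
`--supports stmt-HodgeConjecture-24833 --as helper`; THEOREMS ONLY (no `def`, no `instance`, no `notation`, no named-fact hypothesis, no `sorry`); count-neutral.
`Fin 2` reading of ★ ASM (road «GL-[M6]-sc»).  For `θ = B v₁ (ρ · v₁)` (continuous, supported in a ball `Ω s₀` — ★ 2N-4 F3 `exists_support_height`), the three conjuncts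
of `hNE₂` follow from ★ ASM-core `nonEllEstimates_of_radius` fed with: `hcanc` = ★ F2 `ae_setIntegral_conj_eq_inter` (radius `R x̄ = 22(s₀ + h + L + 1)`); `hball` =
★ 2N-5 part 3 file 2 `K2E3GL2ModUniformizerNonEllBallWeight.ae_setIntegral_norm_conj_le_weight_sharp` (K2E3-p17 (g8)) — the `N = 2` ball bound in the SCALE-INVARIANT
normalisation `δ(mk g) = ‖disc χ_g‖ ∕ ‖det g‖` (first power of `det`), bound `M_θ·(c·(C m · 2(2(R+(4h+L))+1) · q^{h}·δ^{-1∕2}))`; the weight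
`W = K·1_{non-ell}·δ^{-(1∕2+ε)}·(a + b h + c L)²·q^{3h}·δ^{ε}` (★ generic `locallyIntegrable_mul_weightFactor`), `a = 88 s₀ + 90`, `b = 104`, `c = 92`, `ε = 1∕16`,
whose first factor's local integrability is the HYPOTHESIS `hΦ` (= ★ 2N-6's conclusion, K2E3-p24 (g0)); file 4 plugs it.
* **`nonEllEstimates_of_weight`** (single theorem).
[HarishChandra1970, Part V §6 Thm 15 p. 63; Part VII §2 Thms 18–20 pp. 69–70, §3 pp. 70–73]
HONEST LABEL: HC_CM is proved only modulo the 7 printed citations (2 remaining named inputs: hLiu418 = stmt-HodgeConjecture-24832, h413 = stmt-HodgeConjecture-24833) until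
rung 0 closes; count-neutral helper, closes no socket; CONDITIONAL on the binder `hΦ` (★ 2N-6), stated not assumed as a fact.

## References
* [HarishChandra1970] Harish-Chandra (notes by G. van Dijk), *Harmonic Analysis on Reductive p-adic Groups*, LNM 162 (1970), Part V §6 Thm 15 p. 63; Part VII §2–§3 pp. 69–73.
-/

set_option autoImplicit false
-- the mandated namespace repeats the single-problem summit's segment (`HodgeConjecture.HodgeConjecture`)
set_option linter.dupNamespace false

noncomputable section

open MeasureTheory Measure Set Filter Topology
open scoped MatrixGroups NNReal ENNReal WithZero
open Literature.NumberTheory.Automorphic Literature.NumberTheory.GaloisRepresentations Literature.NumberTheory.GaloisRepresentations.IsNonarchimedeanLocalField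
open Summit.HodgeConjecture.HodgeConjecture.Cruxes.H413.K2E3GL2ModUniformizerNonEllCancellation (ae_setIntegral_conj_eq_inter)
open Summit.HodgeConjecture.HodgeConjecture.Cruxes.H413.K2E3GL2ModUniformizerNonEllBallWeight (ae_setIntegral_norm_conj_le_weight_sharp)
open Summit.HodgeConjecture.HodgeConjecture.Cruxes.H413.K2E3GL2SupercuspOrbitalSliceCancellation (exists_support_height)
open Summit.HodgeConjecture.HodgeConjecture.Cruxes.H413.K2E3GL3ModUniformizerNonEllEstimatesOfMixed (toReal_bound_eq inv_sqrt_coe_eq_rpow_mul_rpow)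
open Summit.HodgeConjecture.HodgeConjecture.Cruxes.H413.K2E3GL3ModUniformizerNonEllWeight (locallyIntegrable_mul_weightFactor)
open Summit.HodgeConjecture.HodgeConjecture.Cruxes.H413.K2E3NonEllEstimatesOfRadius (nonEllEstimates_of_radius)

namespace Summit.HodgeConjecture.HodgeConjecture.Cruxes.H413.K2E3GL2ModUniformizerNonEllEstimatesOfWeight

/-! ## The assembly, modulo the local integrability of `1_{non-ell}·δ^{-(1∕2+ε)}` -/

variable {F : Type*} [Field F] [Valued F ℤᵐ⁰] [ValuativeRel F] [(Valued.v : Valuation F ℤᵐ⁰).Compatible] [IsNonarchimedeanLocalField F] [CharZero F]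
  {ϖ : F} (hϖ : Valued.v ϖ = WithZero.exp (-1 : ℤ)) (hϖ0 : ϖ ≠ 0)
  [((Subgroup.zpowers (Units.mk0 ϖ hϖ0)).map (Matrix.GeneralLinearGroup.scalar (Fin 2))).Normal]
  [MeasurableSpace (GL (Fin 2) F ⧸ (Subgroup.zpowers (Units.mk0 ϖ hϖ0)).map (Matrix.GeneralLinearGroup.scalar (Fin 2)))]
  [BorelSpace (GL (Fin 2) F ⧸ (Subgroup.zpowers (Units.mk0 ϖ hϖ0)).map (Matrix.GeneralLinearGroup.scalar (Fin 2)))]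
  (μ : Measure (GL (Fin 2) F ⧸ (Subgroup.zpowers (Units.mk0 ϖ hϖ0)).map (Matrix.GeneralLinearGroup.scalar (Fin 2)))) [μ.IsHaarMeasure]
  (r : SmoothIrrep (GL (Fin 2) F ⧸ (Subgroup.zpowers (Units.mk0 ϖ hϖ0)).map (Matrix.GeneralLinearGroup.scalar (Fin 2)))) (hsc : r.ρ.IsSupercuspidal)
  (B : r.V →ₗ⋆[ℂ] r.V →ₗ[ℂ] ℂ)
  (hBinv : ∀ (g : GL (Fin 2) F ⧸ (Subgroup.zpowers (Units.mk0 ϖ hϖ0)).map (Matrix.GeneralLinearGroup.scalar (Fin 2))) (x y : r.V), B (r.ρ g x) (r.ρ g y) = B x y)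
  (v₁ : r.V)
  (Ω : CompactExhaustion (GL (Fin 2) F ⧸ (Subgroup.zpowers (Units.mk0 ϖ hϖ0)).map (Matrix.GeneralLinearGroup.scalar (Fin 2))))
  (hmem : ∀ (m : ℕ) (g : GL (Fin 2) F),
    (QuotientGroup.mk g : GL (Fin 2) F ⧸ (Subgroup.zpowers (Units.mk0 ϖ hϖ0)).map (Matrix.GeneralLinearGroup.scalar (Fin 2))) ∈ Ω m ↔
      ∀ i j k l, Valued.v (ϖ ^ m * ((g : Matrix (Fin 2) (Fin 2) F) i j * ((g⁻¹ : GL (Fin 2) F) : Matrix (Fin 2) (Fin 2) F) k l)) ≤ 1)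
  (hK : ∀ (m : ℕ) (k : GL (Fin 2) F), k ∈ glInt 2 F → ∀ x : GL (Fin 2) F ⧸ (Subgroup.zpowers (Units.mk0 ϖ hϖ0)).map (Matrix.GeneralLinearGroup.scalar (Fin 2)),
    ((QuotientGroup.mk k : GL (Fin 2) F ⧸ _) * x ∈ Ω m ↔ x ∈ Ω m) ∧ (x * (QuotientGroup.mk k : GL (Fin 2) F ⧸ _) ∈ Ω m ↔ x ∈ Ω m))

include hϖ hsc hBinv hmem hK in
/-- **THE LEAF BODY FOR A GIVEN EXHAUSTION, MODULO THE LOCAL INTEGRABILITY OF THE WEIGHT.**  For `θ = B v₁ (ρ · v₁)`, if for every continuous `δ : G' → ℝ≥0` with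
`δ(mk g) = ‖disc χ_g‖ ∕ ‖det g‖` the weight `1_{Z(y) not compact}·δ^{-(1∕2+1∕16)}` is locally integrable (★ 2N-6), then
`∃ Fl M, (∀ᵐ g, Z(g) not compact → ∫_{Ω n} θ(x g x⁻¹) → Fl g) ∧ (∀ n, ∀ᵐ g, Z(g) not compact → ‖∫_{Ω n} θ(x g x⁻¹)‖ ≤ M g) ∧ M ∈ L¹_loc(μ)` — the three conjuncts of `hNE₂`.
[cite: HarishChandra1970, Part V §6 Thm 15 p. 63; Part VII §2 Thms 18–20 pp. 69–70, §3 pp. 70–73] -/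
theorem nonEllEstimates_of_weight
    (hΦ : ∀ (δ : GL (Fin 2) F ⧸ (Subgroup.zpowers (Units.mk0 ϖ hϖ0)).map (Matrix.GeneralLinearGroup.scalar (Fin 2)) → ℝ≥0), Continuous δ →
      (∀ g : GL (Fin 2) F, δ (QuotientGroup.mk g) =
        normAbs F ((g : Matrix (Fin 2) (Fin 2) F)).charpoly.discr / normAbs F ((g : Matrix (Fin 2) (Fin 2) F)).det) →
      LocallyIntegrable (fun x : GL (Fin 2) F ⧸ (Subgroup.zpowers (Units.mk0 ϖ hϖ0)).map (Matrix.GeneralLinearGroup.scalar (Fin 2)) =>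
        {y : GL (Fin 2) F ⧸ (Subgroup.zpowers (Units.mk0 ϖ hϖ0)).map (Matrix.GeneralLinearGroup.scalar (Fin 2)) |
            ¬ IsCompact ((Subgroup.centralizer ({y} : Set (GL (Fin 2) F ⧸ (Subgroup.zpowers (Units.mk0 ϖ hϖ0)).map (Matrix.GeneralLinearGroup.scalar (Fin 2))))) :
              Set (GL (Fin 2) F ⧸ (Subgroup.zpowers (Units.mk0 ϖ hϖ0)).map (Matrix.GeneralLinearGroup.scalar (Fin 2))))}.indicator
          (fun y => ((δ y : ℝ)) ^ (-(1 / 2 + (1 / 16 : ℝ)))) x) μ) :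
    ∃ (Fl : (GL (Fin 2) F ⧸ (Subgroup.zpowers (Units.mk0 ϖ hϖ0)).map (Matrix.GeneralLinearGroup.scalar (Fin 2))) → ℂ)
      (M : (GL (Fin 2) F ⧸ (Subgroup.zpowers (Units.mk0 ϖ hϖ0)).map (Matrix.GeneralLinearGroup.scalar (Fin 2))) → ℝ),
      (∀ᵐ g ∂μ, ¬ IsCompact ((Subgroup.centralizer ({g} : Set (GL (Fin 2) F ⧸ (Subgroup.zpowers (Units.mk0 ϖ hϖ0)).map (Matrix.GeneralLinearGroup.scalar (Fin 2))))) :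
          Set (GL (Fin 2) F ⧸ (Subgroup.zpowers (Units.mk0 ϖ hϖ0)).map (Matrix.GeneralLinearGroup.scalar (Fin 2)))) →
        Tendsto (fun n => ∫ x in Ω n, B v₁ (r.ρ (x * g * x⁻¹) v₁) ∂μ) atTop (𝓝 (Fl g))) ∧
      (∀ n, ∀ᵐ g ∂μ, ¬ IsCompact ((Subgroup.centralizer ({g} : Set (GL (Fin 2) F ⧸ (Subgroup.zpowers (Units.mk0 ϖ hϖ0)).map (Matrix.GeneralLinearGroup.scalar (Fin 2))))) :
          Set (GL (Fin 2) F ⧸ (Subgroup.zpowers (Units.mk0 ϖ hϖ0)).map (Matrix.GeneralLinearGroup.scalar (Fin 2)))) →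
        ‖∫ x in Ω n, B v₁ (r.ρ (x * g * x⁻¹) v₁) ∂μ‖ ≤ M g) ∧
      LocallyIntegrable M μ := by
  -- §0 frame
  letI : MeasurableSpace F := borel F
  haveI : BorelSpace F := ⟨rfl⟩
  letI : MeasurableSpace (GL (Fin 2) F) := borel _
  haveI : BorelSpace (GL (Fin 2) F) := ⟨rfl⟩
  haveI : T2Space (GL (Fin 2) F ⧸ (Subgroup.zpowers (Units.mk0 ϖ hϖ0)).map (Matrix.GeneralLinearGroup.scalar (Fin 2))) :=
    K2E3GL2ModCocompactCentral.t2Space_quotScalar _ (K2E3GL3ModUniformizerCocompact.isClosed_zpowers_uniformizer hϖ hϖ0)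
  -- the test function `θ = B v₁ (ρ · v₁)`: continuous, supported in `Ω s₀`, bounded by `Mθ`
  have hθc : Continuous fun x : GL (Fin 2) F ⧸ (Subgroup.zpowers (Units.mk0 ϖ hϖ0)).map (Matrix.GeneralLinearGroup.scalar (Fin 2)) => B v₁ (r.ρ x v₁) :=
    ((Representation.IsSmooth.isLocallyConstant_apply r.ρ r.isSmooth v₁).comp fun w : r.V => B v₁ w).continuous
  obtain ⟨s₀, hs₀⟩ := exists_support_height hϖ hϖ0 r.ρ r.isSmooth hsc hBinv v₁ v₁ Ω
  have hsupp : ∀ x, x ∉ Ω s₀ → B v₁ (r.ρ x v₁) = 0 := fun x hx => by_contra (fun h => hx (hs₀ x h))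
  obtain ⟨Mθ, hMθ⟩ := hθc.bounded_above_of_compact_support (HasCompactSupport.intro (Ω.isCompact s₀) hsupp)
  -- the coordinates and the packaged ball estimate
  obtain ⟨hgt, δ, L, hm, hhgt, hhgt', hδc, hδ, hLm, hL1, hL2, -, -⟩ := K2E3GL2ModUniformizerNonEllCoordinates.exists_coordinates hϖ hϖ0 Ω
  obtain ⟨c₀, C, hC, hballθ⟩ := ae_setIntegral_norm_conj_le_weight_sharp (E := ℂ) hϖ hϖ0 μ Ω hmem
  -- the radius and the weight
  obtain ⟨R, hRdef⟩ : ∃ R : GL (Fin 2) F ⧸ (Subgroup.zpowers (Units.mk0 ϖ hϖ0)).map (Matrix.GeneralLinearGroup.scalar (Fin 2)) → ℕ,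
      ∀ x, R x = 22 * (s₀ + hgt x + L x + 1) := ⟨_, fun _ => rfl⟩
  set ε : ℝ := 1 / 16 with hεdef
  have hε0 : 0 < ε := by norm_num [hεdef]
  set q : ℝ := ((residueFieldCard F : ℝ≥0) : ℝ) with hqdef
  have hq1 : 1 < q := by rw [hqdef]; exact_mod_cast one_lt_residueFieldCard_nnreal (F := F)
  have hq0 : 0 < q := zero_lt_one.trans hq1
  set a : ℝ := 88 * (s₀ : ℝ) + 90 with hadef
  set b : ℝ := 104 with hbdef
  set c : ℝ := 92 with hcdef
  have ha : 0 ≤ a := by positivity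
  have hb : 0 ≤ b := by norm_num [hbdef]
  set K₃ : ℝ := Mθ * ((c₀ : ℝ) * (C s₀).toReal) with hK₃def
  obtain ⟨Φ, hΦdef⟩ : ∃ Φ : GL (Fin 2) F ⧸ (Subgroup.zpowers (Units.mk0 ϖ hϖ0)).map (Matrix.GeneralLinearGroup.scalar (Fin 2)) → ℝ, ∀ x, Φ x =
      {y : GL (Fin 2) F ⧸ (Subgroup.zpowers (Units.mk0 ϖ hϖ0)).map (Matrix.GeneralLinearGroup.scalar (Fin 2)) |
        ¬ IsCompact ((Subgroup.centralizer ({y} : Set (GL (Fin 2) F ⧸ (Subgroup.zpowers (Units.mk0 ϖ hϖ0)).map (Matrix.GeneralLinearGroup.scalar (Fin 2))))) :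
          Set (GL (Fin 2) F ⧸ (Subgroup.zpowers (Units.mk0 ϖ hϖ0)).map (Matrix.GeneralLinearGroup.scalar (Fin 2))))}.indicator
      (fun y => ((δ y : ℝ)) ^ (-(1 / 2 + ε))) x := ⟨_, fun _ => rfl⟩
  have hΦli : LocallyIntegrable Φ μ := by
    have hΦeq : Φ = fun x => {y : GL (Fin 2) F ⧸ (Subgroup.zpowers (Units.mk0 ϖ hϖ0)).map (Matrix.GeneralLinearGroup.scalar (Fin 2)) |
        ¬ IsCompact ((Subgroup.centralizer ({y} : Set (GL (Fin 2) F ⧸ (Subgroup.zpowers (Units.mk0 ϖ hϖ0)).map (Matrix.GeneralLinearGroup.scalar (Fin 2))))) :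
          Set (GL (Fin 2) F ⧸ (Subgroup.zpowers (Units.mk0 ϖ hϖ0)).map (Matrix.GeneralLinearGroup.scalar (Fin 2))))}.indicator
      (fun y => ((δ y : ℝ)) ^ (-(1 / 2 + ε))) x := funext hΦdef
    rw [hΦeq]; exact hΦ δ hδc hδ
  obtain ⟨G, hGdef⟩ : ∃ G : GL (Fin 2) F ⧸ (Subgroup.zpowers (Units.mk0 ϖ hϖ0)).map (Matrix.GeneralLinearGroup.scalar (Fin 2)) → ℝ, ∀ x, G x =
      (a + b * (hgt x : ℝ) + c * (L x : ℝ)) ^ 2 * q ^ (3 * hgt x) * ((δ x : ℝ)) ^ ε := ⟨_, fun _ => rfl⟩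
  have hGeq : G = fun x => (a + b * (hgt x : ℝ) + c * (L x : ℝ)) ^ 2 * q ^ (3 * hgt x) * ((δ x : ℝ)) ^ ε := funext hGdef
  have hL0 : ∀ x, 0 < L x → δ x < ((q⁻¹ : ℝ).toNNReal) ^ (L x - 1) := fun x hx => by
    have : (q⁻¹ : ℝ).toNNReal = (residueFieldCard F : ℝ≥0)⁻¹ := by rw [hqdef, ← NNReal.coe_inv, Real.toNNReal_coe]
    rw [this]; exact hL2 x hx
  have hW : LocallyIntegrable (K₃ • fun x => Φ x * G x) μ := by
    rw [hGeq]; exact (locallyIntegrable_mul_weightFactor Ω hΦli hm hhgt' hδc hLm hq1 hL0 ha hb hε0 (c := c)).smul K₃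
  -- ★ ASM-core
  refine nonEllEstimates_of_radius μ hθc Ω
    (fun x => IsCompact ((Subgroup.centralizer ({x} : Set (GL (Fin 2) F ⧸ (Subgroup.zpowers (Units.mk0 ϖ hϖ0)).map (Matrix.GeneralLinearGroup.scalar (Fin 2))))) :
      Set (GL (Fin 2) F ⧸ (Subgroup.zpowers (Units.mk0 ϖ hϖ0)).map (Matrix.GeneralLinearGroup.scalar (Fin 2)))))
    R (K₃ • fun x => Φ x * G x) (fun n => ?_) ?_ hW
  · -- `hcanc`
    have hReq : R = fun x => 22 * (s₀ + hgt x + L x + 1) := funext hRdef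
    rw [hReq]
    exact ae_setIntegral_conj_eq_inter hϖ hϖ0 r.ρ r.isSmooth hsc hBinv v₁ v₁ Ω hmem hK μ hs₀ hgt δ L hhgt hδ hL1 n
  · -- `hball`: the packaged bound, then `RHS ≤ W` pointwise
    filter_upwards [hballθ (fun x => B v₁ (r.ρ x v₁)) Mθ s₀ hMθ hsupp hgt δ L R hhgt hδ hL1] with x hx hnc
    refine (hx hnc).trans ?_
    have hMθ0 : 0 ≤ Mθ := (norm_nonneg _).trans (hMθ 1)
    have hK₃0 : 0 ≤ K₃ := by rw [hK₃def]; positivity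
    rw [toReal_bound_eq, Pi.smul_apply, smul_eq_mul]
    have hΦx : Φ x = ((δ x : ℝ)) ^ (-(1 / 2 + ε)) := by rw [hΦdef]; exact indicator_of_mem hnc _
    -- the linear count `n(x) = a + b h + c L ≥ 1` is dominated by its square, `q^h ≤ q^{3h}`
    have hn : (((2 * (2 * (R x + (4 * hgt x + L x)) + 1) : ℕ)) : ℝ) = a + b * (hgt x : ℝ) + c * (L x : ℝ) := by
      simp only [hRdef, hadef, hbdef, hcdef]; push_cast; ring
    have hn1 : (1 : ℝ) ≤ a + b * (hgt x : ℝ) + c * (L x : ℝ) := by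
      rw [← hn]; exact_mod_cast Nat.succ_le_of_lt (by positivity)
    have hn0 : (0 : ℝ) ≤ a + b * (hgt x : ℝ) + c * (L x : ℝ) := zero_le_one.trans hn1
    have hnsq : a + b * (hgt x : ℝ) + c * (L x : ℝ) ≤ (a + b * (hgt x : ℝ) + c * (L x : ℝ)) ^ 2 := by
      rw [sq]; exact le_mul_of_one_le_left hn0 hn1
    have hqh : q ^ (hgt x) ≤ q ^ (3 * hgt x) := pow_le_pow_right₀ hq1.le (by omega)
    have hcore : (a + b * (hgt x : ℝ) + c * (L x : ℝ)) * q ^ (hgt x) ≤ (a + b * (hgt x : ℝ) + c * (L x : ℝ)) ^ 2 * q ^ (3 * hgt x) :=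
      mul_le_mul hnsq hqh (pow_nonneg hq0.le _) (sq_nonneg _)
    by_cases hδ0 : δ x = 0
    · -- both sides: LHS vanishes, RHS ≥ 0
      have hX : (((residueFieldCard F : ℝ≥0) ^ (hgt x) * (NNReal.sqrt (δ x))⁻¹ : ℝ≥0) : ℝ) = 0 := by
        rw [hδ0, NNReal.sqrt_zero, inv_zero, mul_zero, NNReal.coe_zero]
      rw [hX, mul_zero, mul_zero]
      refine mul_nonneg hK₃0 (mul_nonneg ?_ ?_)
      · rw [hΦx]; exact Real.rpow_nonneg (δ x).2 _
      · rw [hGdef]; exact mul_nonneg (mul_nonneg (sq_nonneg _) (pow_nonneg hq0.le _)) (Real.rpow_nonneg (δ x).2 _)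
    · have hs : (((NNReal.sqrt (δ x))⁻¹ : ℝ≥0) : ℝ) = ((δ x : ℝ)) ^ (-(1 / 2 + ε)) * ((δ x : ℝ)) ^ ε := by
        rw [NNReal.coe_inv]; exact inv_sqrt_coe_eq_rpow_mul_rpow hδ0 ε
      have hP0 : 0 ≤ K₃ * (((δ x : ℝ)) ^ (-(1 / 2 + ε)) * ((δ x : ℝ)) ^ ε) :=
        mul_nonneg hK₃0 (mul_nonneg (Real.rpow_nonneg (δ x).2 _) (Real.rpow_nonneg (δ x).2 _))
      have eL : Mθ * ((c₀ : ℝ) * (C s₀).toReal * (((2 * (2 * (R x + (4 * hgt x + L x)) + 1) : ℕ)) : ℝ) *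
          ((((residueFieldCard F : ℝ≥0) ^ (hgt x) * (NNReal.sqrt (δ x))⁻¹ : ℝ≥0)) : ℝ)) =
          (K₃ * (((δ x : ℝ)) ^ (-(1 / 2 + ε)) * ((δ x : ℝ)) ^ ε)) * ((a + b * (hgt x : ℝ) + c * (L x : ℝ)) * q ^ (hgt x)) := by
        rw [hn, NNReal.coe_mul, NNReal.coe_pow, hs]
        simp only [hK₃def, hqdef]; ring
      have eR : K₃ * (Φ x * G x) = (K₃ * (((δ x : ℝ)) ^ (-(1 / 2 + ε)) * ((δ x : ℝ)) ^ ε)) * ((a + b * (hgt x : ℝ) + c * (L x : ℝ)) ^ 2 * q ^ (3 * hgt x)) := by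
        rw [hΦx, hGdef]; ring
      rw [eL, eR]
      exact mul_le_mul_of_nonneg_left hcore hP0

end Summit.HodgeConjecture.HodgeConjecture.Cruxes.H413.K2E3GL2ModUniformizerNonEllEstimatesOfWeight

end
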